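import Mathlib.Topology.Algebra.ClopenNhdofOne
import Literature.NumberTheory.GaloisRepresentations.ProjectiveLiftingProofs
import Literature.NumberTheory.EllipticCurves.PeriodIndexSupport
import HarnessLib

/-!
# Tate's lifting theorem for projective representations: the ramification layer

Second sibling proof file of `ProjectiveLifting.lean` (named fact
`Patrikis2019_exists_lift_projective`), on top of the obstruction-theoretic layer
`ProjectiveLiftingProofs.lean`.  Theorems only: no definition, no named fact (D-0026).

Part (ii) of the fact is the Remark following Prop. 1.0.18 of S. Patrikis, *Variations on a
theorem of Tate*, Mem. AMS 1238 (2019), §2.1 (third item; = B. Conrad, *Lifting global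
representations with local properties*, Lemma 5.2): "If `ρ` is almost everywhere unramified,
then it is easy to see that `ρ̃` is almost everywhere unramified", combined with the second
item of the same Remark: "in the case of `GL_n → PGL_n`, this proof produces lifts with
finite-order determinant".  For a lift `W : Γ_F → GL_n(K)` of `r : Γ_F → PGL_n(K)` with
`(det W)^M = 1` the argument is elementary and is carried out here for any number field `F`
and any Hausdorff integral domain of coefficients `K`:

* at a place `v` where `r` is unramified, `W(I_𝔓)` lies in the centre of `GL_n(K)`, i.e. in
  the scalars `c · 1`, and `det = c^n` forces `c^{nM} = 1`: so `W(I_𝔓)` lies in the FINITE set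
  `Z = μ_{nM}(K) · 1`;
* `Z \ {1}` is finite, hence closed, so `V = W⁻¹((Z \ {1})ᶜ)` is an open neighbourhood of `1`
  in the profinite group `Γ_F`, which therefore contains an open normal subgroup `U`
  (Mathlib `ProfiniteGrp.exist_openNormalSubgroup_sub_open_nhds_of_one`);
* an open normal subgroup of `Γ_F` contains the inertia groups `I_𝔓`, `𝔓 ∣ v`, for all but
  finitely many `v` (the tree's `Literature.NumberTheory.EllipticCurves.eventually_forall_inertia_le`:
  `U = Gal(F̄/L)` for a finite Galois `L/F`, and only the finitely many `v` below the different
  of `L/F` ramify in `L`);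
* hence for all but finitely many `v`, `W(I_𝔓) ⊆ Z ∩ (Z \ {1})ᶜ = {1}`.

Whence `FramedGaloisRep.eventually_isUnramifiedAt_of_lift_of_det_pow_eq_one` (part (ii) for
finite-order-determinant lifts), and, combined with
`Patrikis2019_exists_lift_det_pow_eq_one_of_H2_addCircle` of the sibling file, the reduction of
the WHOLE named fact to Tate's theorem `H²(Γ_F, ℚ/ℤ) = 0` in locally-constant-cochain form
(`Patrikis2019_exists_lift_projective_of_H2_addCircle`).  Tate's theorem itself (Patrikis
Thm. 1.0.16 = Serre, Durham survey, Thm. 4: global class field theory — the local–global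
structure of the Brauer group and an extension lemma for finite-order Hecke characters) is not
available in Mathlib or in this tree, so `Patrikis2019_exists_lift_projective` is still not
discharged; after this file it is *equivalent in difficulty* to exactly that one theorem.

## References

* S. Patrikis, *Variations on a theorem of Tate*, Mem. Amer. Math. Soc. 258 (2019), no. 1238,
  §2.1: Thm. 1.0.16 (Tate), Prop. 1.0.18 (= Conrad Prop. 5.3) and the Remark following it,
  items (2) (finite-order determinant) and (3) (= Conrad Lemma 5.2). [`Patrikis2019`]
* B. Conrad, *Lifting global representations with local properties*, preprint (2011), §5,
  Prop. 5.3 and Lemma 5.2.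
* J.-P. Serre, *Abelian ℓ-adic representations and elliptic curves* (1968), Ch. I §2.1;
  J. Neukirch, *Algebraic Number Theory* (1999), Ch. III §2 Thm. (2.6) (only finitely many
  primes ramify in a finite extension).

## Mathlib / tree search

Mathlib: `ProfiniteGrp.exist_openNormalSubgroup_sub_open_nhds_of_one`,
`Matrix.GeneralLinearGroup.center_eq_range_scalar`, `Matrix.GeneralLinearGroup.det_scalar`,
`rootsOfUnity` (finite in a domain), `Set.Finite.isClosed`.  Tree:
`Literature.NumberTheory.EllipticCurves.eventually_forall_inertia_le` (PeriodIndexSupport.lean),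
`FramedGaloisRep.eventually_isUnramifiedAt_of_isOpen_ker` (ArtinRestriction.lean, the open-kernel
case, not applicable to `ℓ`-adic `W`), `Patrikis2019_exists_lift_det_pow_eq_one_of_H2_addCircle`
(ProjectiveLiftingProofs.lean).
-/

noncomputable section

open scoped NumberField
open Field IsDedekindDomain

namespace Literature.NumberTheory.GaloisRepresentations

universe u v

/-! ### Conrad's Lemma 5.2 for lifts with finite-order determinant -/

section FiniteOrderDet

variable {F : Type u} [Field F] [NumberField F]
variable {A : Type v} [CommRing A] [IsDomain A] [TopologicalSpace A] [T2Space A] {n : ℕ}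

/-- **A representation that is central on almost all inertia groups and has finite-order
determinant is unramified almost everywhere.**  Let `W : Γ_F → GL_n(A)` be continuous (`A` a
Hausdorff integral domain) with `(det W)^M = 1`, `M ≥ 1`, and suppose that for all but finitely
many finite places `v` of the number field `F` every inertia group `I_𝔓`, `𝔓 ∣ v`, is mapped
into the centre of `GL_n(A)`.  Then `W` is unramified at all but finitely many `v`.  (On such
`I_𝔓`, `W` takes values in the finite set `μ_{nM}(A) · 1`; the open neighbourhood
`W⁻¹((μ_{nM} · 1 ∖ {1})ᶜ)` of `1 ∈ Γ_F` contains an open normal subgroup, which contains `I_𝔓`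
for all but finitely many `v`.)  This is the argument behind Patrikis 2019, §2.1, Remark after
Prop. 1.0.18, items (2)–(3) (= Conrad, Lemma 5.2) for the lifts with finite-order determinant
produced by the proof of Prop. 1.0.18.
[cite: Patrikis2019, §2.1 Remark after Prop. 1.0.18, (2)–(3)] -/
theorem FramedGaloisRep.eventually_isUnramifiedAt_of_center_of_det_pow_eq_one
    (W : FramedGaloisRep F A n) {M : ℕ} (hM : 0 < M)
    (hdet : ∀ σ, Matrix.GeneralLinearGroup.det (W σ) ^ M = 1)
    (hr : ∀ᶠ v : HeightOneSpectrum (𝓞 F) in Filter.cofinite, ∀ 𝔓 ∈ v.primesAbove,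
      ∀ σ ∈ 𝔓.inertia (absoluteGaloisGroup F), W σ ∈ Subgroup.center (GL (Fin n) A)) :
    ∀ᶠ v : HeightOneSpectrum (𝓞 F) in Filter.cofinite, W.IsUnramifiedAt v := by
  classical
  rcases Nat.eq_zero_or_pos n with hn | hn
  · subst hn
    exact Filter.Eventually.of_forall fun v 𝔓 _ σ _ => Subsingleton.elim _ _
  haveI : NeZero (n * M) := ⟨(Nat.mul_pos hn hM).ne'⟩
  -- the finite set `Z = μ_{nM}(A) · 1` of scalar roots of unity, and `B = Z ∖ {1}`
  set Z : Set (GL (Fin n) A) := Set.range fun ζ : rootsOfUnity (n * M) A =>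
    Matrix.GeneralLinearGroup.scalar (Fin n) (ζ : Aˣ) with hZdef
  have hZfin : Z.Finite := Set.finite_range _
  set B : Set (GL (Fin n) A) := Z \ {1} with hBdef
  have hBclosed : IsClosed B := (hZfin.subset fun x hx => hx.1).isClosed
  -- `V = W⁻¹(Bᶜ)` is an open neighbourhood of `1`, so contains an open normal subgroup `U`
  have hVopen : IsOpen ((W : absoluteGaloisGroup F → GL (Fin n) A) ⁻¹' Bᶜ) :=
    hBclosed.isOpen_compl.preimage (map_continuous W)
  have h1V : (1 : absoluteGaloisGroup F) ∈ (W : absoluteGaloisGroup F → GL (Fin n) A) ⁻¹' Bᶜ := by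
    change W 1 ∉ B
    rw [map_one]
    exact fun h => h.2 rfl
  obtain ⟨U, hU⟩ := ProfiniteGrp.exist_openNormalSubgroup_sub_open_nhds_of_one hVopen h1V
  -- inertia groups eventually lie in `U`
  have hI := Literature.NumberTheory.EllipticCurves.eventually_forall_inertia_le
    (U : Subgroup (absoluteGaloisGroup F)) U.isOpen
  filter_upwards [hr, hI] with v hv hIv
  intro 𝔓 h𝔓 σ hσ
  -- `W σ` is a scalar root of unity ...
  have hcen : W σ ∈ Subgroup.center (GL (Fin n) A) := hv 𝔓 h𝔓 σ hσ
  rw [Matrix.GeneralLinearGroup.center_eq_range_scalar] at hcen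
  obtain ⟨u, hu⟩ := hcen
  have huZ : W σ ∈ Z := by
    have h := hdet σ
    rw [← hu, Matrix.GeneralLinearGroup.det_scalar, Fintype.card_fin, ← pow_mul] at h
    exact ⟨⟨u, (mem_rootsOfUnity _ _).2 h⟩, hu⟩
  -- ... and lies outside `B = Z ∖ {1}` since `σ ∈ I_𝔓 ≤ U ⊆ W⁻¹(Bᶜ)`
  have hσU : σ ∈ (U : Set (absoluteGaloisGroup F)) := hIv 𝔓 h𝔓 hσ
  have hnotB : W σ ∉ B := hU hσU
  by_contra hne
  exact hnotB ⟨huZ, hne⟩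

/-- **Conrad's Lemma 5.2 / Patrikis 2019, Remark after Prop. 1.0.18 (3), for lifts with
finite-order determinant.**  Let `r : Γ_F → PGL_n(A) = GL_n(A) ⧸ centre` be a projective
representation of the absolute Galois group of a number field `F` (`A` a Hausdorff integral
domain) which is unramified at all but finitely many finite places (every inertia group above
such a place dies), and let `W : Γ_F → GL_n(A)` be a continuous lift of `r` with finite-order
determinant, `(det W)^M = 1` ("in the case of `GL_n → PGL_n`, this proof produces lifts with
finite-order determinant").  Then `W` is unramified at all but finitely many places ("If `ρ` is
almost everywhere unramified, then it is easy to see that `ρ̃` is almost everywhere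
unramified").
[cite: Patrikis2019, §2.1 Remark after Prop. 1.0.18, (2)–(3) (= Conrad, Lemma 5.2)] -/
theorem FramedGaloisRep.eventually_isUnramifiedAt_of_lift_of_det_pow_eq_one
    (r : absoluteGaloisGroup F →* GL (Fin n) A ⧸ Subgroup.center (GL (Fin n) A))
    (W : FramedGaloisRep F A n)
    (hW : ∀ σ, (QuotientGroup.mk (W σ) : GL (Fin n) A ⧸ Subgroup.center _) = r σ)
    {M : ℕ} (hM : 0 < M) (hdet : ∀ σ, Matrix.GeneralLinearGroup.det (W σ) ^ M = 1)
    (hr : ∀ᶠ v : HeightOneSpectrum (𝓞 F) in Filter.cofinite, ∀ 𝔓 ∈ v.primesAbove,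
      ∀ σ ∈ 𝔓.inertia (absoluteGaloisGroup F), r σ = 1) :
    ∀ᶠ v : HeightOneSpectrum (𝓞 F) in Filter.cofinite, W.IsUnramifiedAt v := by
  refine W.eventually_isUnramifiedAt_of_center_of_det_pow_eq_one hM hdet (hr.mono ?_)
  intro v hv 𝔓 h𝔓 σ hσ
  rw [← QuotientGroup.eq_one_iff, hW σ]
  exact hv 𝔓 h𝔓 σ hσ

end FiniteOrderDet

/-! ### The named fact from Tate's theorem in `ℚ/ℤ`-cochain form -/

section NumberField

/-- **Both parts of `Patrikis2019_exists_lift_projective` for one `(F, ℓ, n)`, from Tate's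
theorem for `F` in `ℚ/ℤ`-cochain form.**  If every locally constant `2`-cocycle
`Γ_F × Γ_F → ℚ/ℤ = AddCircle (1 : ℚ)` (trivial action) is the coboundary of a locally constant
cochain (Tate: `H²(Γ_F, ℚ/ℤ) = 0`, Patrikis Thm. 1.0.16 = Serre's Durham survey Thm. 4 — global
class field theory, not available in this tree), then (i) every continuous
`r : Γ_F → PGL_n(ℚ̄_ℓ)` has a continuous lift `W : Γ_F → GL_n(ℚ̄_ℓ)`
(`Patrikis2019_exists_lift_of_H2_addCircle`), and (ii) if `r` is unramified at all but
finitely many places then some lift is too: take the lift with finite-order determinant of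
`Patrikis2019_exists_lift_det_pow_eq_one_of_H2_addCircle` (Remark (2)) and apply
`FramedGaloisRep.eventually_isUnramifiedAt_of_lift_of_det_pow_eq_one` (Remark (3) = Conrad
Lemma 5.2).
[cite: Patrikis2019, §2.1 Thm. 1.0.16, Prop. 1.0.18 and the Remark following it] -/
theorem Patrikis2019_exists_lift_projective_parts_of_H2_addCircle (F : Type) [Field F]
    [NumberField F] (ℓ n : ℕ) [Fact ℓ.Prime]
    (hTate : ∀ f : absoluteGaloisGroup F → absoluteGaloisGroup F → AddCircle (1 : ℚ),
      IsLocallyConstant (Function.uncurry f) →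
      (∀ σ τ υ, f σ τ + f (σ * τ) υ = f τ υ + f σ (τ * υ)) →
      ∃ b : absoluteGaloisGroup F → AddCircle (1 : ℚ), IsLocallyConstant b ∧
        ∀ σ τ, f σ τ + b (σ * τ) = b σ + b τ)
    (r : absoluteGaloisGroup F →ₜ*
      (GL (Fin n) (PadicAlgCl ℓ) ⧸ Subgroup.center (GL (Fin n) (PadicAlgCl ℓ)))) :
    (∃ W : FramedGaloisRep F (PadicAlgCl ℓ) n,
        ∀ σ, (QuotientGroup.mk (W σ) : GL (Fin n) (PadicAlgCl ℓ) ⧸ Subgroup.center _) = r σ) ∧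
      ((∀ᶠ v : HeightOneSpectrum (𝓞 F) in Filter.cofinite,
          ∀ 𝔓 ∈ v.primesAbove, ∀ σ ∈ 𝔓.inertia (absoluteGaloisGroup F), r σ = 1) →
        ∃ W : FramedGaloisRep F (PadicAlgCl ℓ) n,
          (∀ σ, (QuotientGroup.mk (W σ) : GL (Fin n) (PadicAlgCl ℓ) ⧸ Subgroup.center _) = r σ) ∧
            ∀ᶠ v : HeightOneSpectrum (𝓞 F) in Filter.cofinite, W.IsUnramifiedAt v) := by
  refine ⟨Patrikis2019_exists_lift_of_H2_addCircle F ℓ n hTate r, fun hr => ?_⟩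
  obtain ⟨W, N, hN, hW, hdet⟩ :=
    Patrikis2019_exists_lift_det_pow_eq_one_of_H2_addCircle F ℓ n hTate r
  refine ⟨W, hW, ?_⟩
  refine FramedGaloisRep.eventually_isUnramifiedAt_of_lift_of_det_pow_eq_one
    (r : absoluteGaloisGroup F →* _) W hW hN (fun σ => ?_) hr
  ext
  rw [Units.val_pow_eq_pow_val, Matrix.GeneralLinearGroup.val_det_apply, Units.val_one]
  exact hdet σ

/-- **`Patrikis2019_exists_lift_projective` from Tate's theorem.**  The named fact (Tate's
lifting theorem for projective `ℓ`-adic representations of `Γ_F`, with control of ramification: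
Patrikis 2019, §2.1, Prop. 1.0.18 and the Remark following it; Conrad, Prop. 5.3 and Lemma 5.2)
follows from Tate's theorem `H²(Γ_F, ℚ/ℤ) = 0` for every number field `F` (Patrikis
Thm. 1.0.16 = Serre's Durham survey Thm. 4), stated in locally-constant-cochain form: every
locally constant `2`-cocycle `Γ_F × Γ_F → ℚ/ℤ` with trivial action is the coboundary of a
locally constant cochain.  This is the complete printed deduction
"Thm. 1.0.16 ⟹ Prop. 1.0.18 + Remark" for `GL_n ↠ PGL_n`; only Thm. 1.0.16 itself (global class
field theory) remains outside the tree.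
[cite: Patrikis2019, §2.1 Thm. 1.0.16, Prop. 1.0.18 and the Remark following it] -/
theorem Patrikis2019_exists_lift_projective_of_H2_addCircle
    (hTate : ∀ (F : Type) [Field F] [NumberField F]
      (f : absoluteGaloisGroup F → absoluteGaloisGroup F → AddCircle (1 : ℚ)),
      IsLocallyConstant (Function.uncurry f) →
      (∀ σ τ υ, f σ τ + f (σ * τ) υ = f τ υ + f σ (τ * υ)) →
      ∃ b : absoluteGaloisGroup F → AddCircle (1 : ℚ), IsLocallyConstant b ∧
        ∀ σ τ, f σ τ + b (σ * τ) = b σ + b τ) :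
    Patrikis2019_exists_lift_projective :=
  fun F _ _ ℓ n _ r => Patrikis2019_exists_lift_projective_parts_of_H2_addCircle F ℓ n (hTate F) r

end NumberField

end Literature.NumberTheory.GaloisRepresentations
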